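import Summits.Ventures.HSemireg.WedgeHankelRecurrenceGaussChebyshevTLevelSetRootsReal

/-!
# Venture HSemireg — **ROOT MULTIPLICITIES ON THE CHEBYSHEV LEVEL SETS: the interior alternation points are DOUBLE roots of `T_n ∓ 1` and the endpoints `±1` are SIMPLE** —
# `mult(cos(2jπ∕(2k+1)), T_{2k+1} − 1) = 2` (`1 ≤ j ≤ k`), `mult(cos((2j+1)π∕(2k+1)), T_{2k+1} + 1) = 2` (`j < k`), `mult(cos(jπ∕(k+1)), T_{2k+2} − 1) = 2` (`1 ≤ j ≤ k`),
# `mult(cos((2j+1)π∕2k), T_{2k} + 1) = 2`, `mult(1, T_n − 1) = 1` (`n ≥ 1`), `mult(−1, T_{2k+2} − 1) = mult(−1, T_{2k+1} + 1) = 1`; and the dilated forms `mult(2cos(2jπ∕n), C_n − 2) = 2`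
# (`0 < 2j < n`), `mult(2, C_n − 2) = 1` (`n ≥ 1`)

HONEST FRAMING. Part of the Lean index of the computation cell `pub-hsemireg` (seat p10 gen 49, Sunday typer «UNIFORM-IN-n»).  Real polynomial algebra and trigonometry only (Mathlib
`Polynomial.Chebyshev.T ∕ C`, `Polynomial.rootMultiplicity`, `Real.cos`); no variety, no cohomology theory, no sheaf, no Ext group and no semiregularity map is constructed here; nothing here
says that HC / HC_CM / HC_AV holds; no Literature fact (unproved `Prop`) is declared or used.  Custodian versions as in `WedgeHankelSiegelIdeal` (1/3).
SOURCES (cited).  T. J. Rivlin, *The Chebyshev Polynomials* (1974), §1.2 (alternation points `η_j = cos(jπ∕n)`, `T_n(η_j) = (−1)^j`, `T_n'(η_j) = 0` for `0 < j < n`) and §2.7; J. C. Mason, D. C. Handscomb,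
*Chebyshev Polynomials* (2003), §2.2; P. Ribenboim, *My Numbers, My Friends* (2000), Ch. 1 §IV.
PROOF TYPED HERE.  `rootMultiplicity = count in roots` (Mathlib `count_roots`) on the explicit multisets of N504 (`T_n ∓ 1`) and N502 (`C_n ∓ 2`): the interior points occur once in the
simple-root multiset (nodup, N503 ∕ N501 ∕ Mathlib) and are `≠ ±1` (resp. `≠ ±2`) because their angle lies in `(0, π)` (N501 `cos_ne_one_and_ne_neg_one_of_pos_of_lt_pi`).
DEDUP DISCLOSURE (`rg -n 'rootMultiplicity' Summits/Ventures/HSemireg/WedgeHankelRecurrenceGauss*`, `lean search rootMultiplicity_T`, 2026-09-04): Mathlib `rootMultiplicity_T_real ∕ _U_real`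
(simple zeros of `T_n`, `U_n`), N500 (`S_n`, `C_n`); no multiplicity statement for the level sets is in the tree; 0 hits for the 12 names below.

WHAT IS IN THE TREE.  N502, N504 (the multisets); N501 `cos_ne_one_and_ne_neg_one_of_pos_of_lt_pi`, nodup lemmas of N501 ∕ N503 ∕ N504.
THIS FILE (namespace `Summit.Ventures.HSemireg.Wedge.HankelOuter` continued; CHAINED on N504; 0 definitions):
* §1270 `angle_even_mem`, `angle_odd_mem`, `angle_half_mem` (the three angle families lie in `(0, π)`), **`chebyshevT_odd_sub_one_rootMultiplicity_cos`**, **`chebyshevT_odd_add_one_rootMultiplicity_cos`**,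
  **`chebyshevT_even_sub_one_rootMultiplicity_cos`**, **`chebyshevT_even_add_one_rootMultiplicity_cos`**, `chebyshevT_sub_one_rootMultiplicity_one`, `chebyshevT_even_sub_one_rootMultiplicity_neg_one`,
  `chebyshevT_odd_add_one_rootMultiplicity_neg_one`, **`chebyshevC_odd_sub_two_rootMultiplicity_cos`**, **`chebyshevC_even_sub_two_rootMultiplicity_cos`**, `chebyshevC_sub_two_rootMultiplicity_two`.
CAVEATS.  Indices as in N502 ∕ N504.  Nothing Ext-side.  New names only.
-/

open Module Polynomial Real
open scoped Matrix Polynomial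

namespace Summit.Ventures.HSemireg.Wedge.HankelOuter

/-! ## §1270. Multiplicities on the level sets -/

/-- `0 < 2(j+1)π∕(2k+1) < π` for `j < k`. [bookkeeping; this file, §1270] -/
theorem angle_even_mem {j k : ℕ} (hj : j < k) : 0 < 2 * ((j : ℝ) + 1) * π / (2 * k + 1) ∧ 2 * ((j : ℝ) + 1) * π / (2 * k + 1) < π := by
  refine ⟨by positivity, ?_⟩
  rw [div_lt_iff₀ (by positivity)]
  have : (j : ℝ) + 1 ≤ k := by exact_mod_cast Nat.lt_iff_add_one_le.mp hj
  nlinarith [pi_pos]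

/-- `0 < (2j+1)π∕(2k+1) < π` for `j < k`. [bookkeeping; this file, §1270] -/
theorem angle_odd_mem {j k : ℕ} (hj : j < k) : 0 < (2 * (j : ℝ) + 1) * π / (2 * k + 1) ∧ (2 * (j : ℝ) + 1) * π / (2 * k + 1) < π := by
  refine ⟨by positivity, ?_⟩
  rw [div_lt_iff₀ (by positivity)]
  have : (j : ℝ) + 1 ≤ k := by exact_mod_cast Nat.lt_iff_add_one_le.mp hj
  nlinarith [pi_pos]

/-- `0 < (j+1)π∕(k+1) < π` and `0 < (2j+1)π∕2k < π` for `j < k`. [bookkeeping; this file, §1270] -/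
theorem angle_half_mem {j k : ℕ} (hj : j < k) :
    (0 < ((j : ℝ) + 1) * π / (k + 1) ∧ ((j : ℝ) + 1) * π / (k + 1) < π) ∧ (0 < (2 * (j : ℝ) + 1) * π / (2 * k) ∧ (2 * (j : ℝ) + 1) * π / (2 * k) < π) := by
  have hk : (0 : ℝ) < k := by exact_mod_cast (Nat.zero_le j).trans_lt hj
  have : (j : ℝ) + 1 ≤ k := by exact_mod_cast Nat.lt_iff_add_one_le.mp hj
  refine ⟨⟨by positivity, ?_⟩, ⟨by positivity, ?_⟩⟩
  · rw [div_lt_iff₀ (by positivity)]; nlinarith [pi_pos]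
  · rw [div_lt_iff₀ (by positivity)]; nlinarith [pi_pos]

/-- **`mult(cos(2(j+1)π∕(2k+1)), T_{2k+1} − 1) = 2`** (`j < k`): the interior maxima of `T_{2k+1}` are double roots of `T_{2k+1} − 1`. [Rivlin §1.2; this file, §1270] -/
theorem chebyshevT_odd_sub_one_rootMultiplicity_cos {j k : ℕ} (hj : j < k) :
    (Polynomial.Chebyshev.T ℝ (2 * (k : ℤ) + 1) - 1).rootMultiplicity (cos (2 * (j + 1) * π / (2 * k + 1))) = 2 := by
  have hne : cos (2 * ((j : ℝ) + 1) * π / (2 * k + 1)) ≠ 1 := (cos_ne_one_and_ne_neg_one_of_pos_of_lt_pi (angle_even_mem hj).1 (angle_even_mem hj).2).1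
  rw [← count_roots, chebyshevT_odd_sub_one_roots_real, Multiset.count_add, Multiset.count_nsmul, Multiset.count_singleton, if_neg hne,
    Multiset.count_eq_one_of_mem (chebyshevW_roots_real_nodup k) (Multiset.mem_map.mpr ⟨j, Multiset.mem_range.mpr hj, rfl⟩)]

/-- **`mult(cos((2j+1)π∕(2k+1)), T_{2k+1} + 1) = 2`** (`j < k`): the interior minima of `T_{2k+1}` are double roots of `T_{2k+1} + 1`. [Rivlin §1.2; this file, §1270] -/
theorem chebyshevT_odd_add_one_rootMultiplicity_cos {j k : ℕ} (hj : j < k) :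
    (Polynomial.Chebyshev.T ℝ (2 * (k : ℤ) + 1) + 1).rootMultiplicity (cos ((2 * j + 1) * π / (2 * k + 1))) = 2 := by
  have hne : cos ((2 * (j : ℝ) + 1) * π / (2 * k + 1)) ≠ -1 := (cos_ne_one_and_ne_neg_one_of_pos_of_lt_pi (angle_odd_mem hj).1 (angle_odd_mem hj).2).2
  rw [← count_roots, chebyshevT_odd_add_one_roots_real, Multiset.count_add, Multiset.count_nsmul, Multiset.count_singleton, if_neg hne,
    Multiset.count_eq_one_of_mem (chebyshevV_roots_real_nodup k) (Multiset.mem_map.mpr ⟨j, Multiset.mem_range.mpr hj, rfl⟩)]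

/-- **`mult(cos((j+1)π∕(k+1)), T_{2k+2} − 1) = 2`** (`j < k`): the interior maxima of `T_{2k+2}` are double roots of `T_{2k+2} − 1`. [Rivlin §1.2; this file, §1270] -/
theorem chebyshevT_even_sub_one_rootMultiplicity_cos {j k : ℕ} (hj : j < k) :
    (Polynomial.Chebyshev.T ℝ (2 * ((k : ℤ) + 1)) - 1).rootMultiplicity (cos ((j + 1) * π / (k + 1))) = 2 := by
  obtain ⟨hne1, hne2⟩ := cos_ne_one_and_ne_neg_one_of_pos_of_lt_pi (angle_half_mem hj).1.1 (angle_half_mem hj).1.2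
  rw [← count_roots, chebyshevT_even_sub_one_roots_real, Multiset.count_add, Multiset.count_nsmul, Multiset.insert_eq_cons, Multiset.count_cons_of_ne hne1, Multiset.count_singleton,
    if_neg hne2, Multiset.count_eq_one_of_mem (Polynomial.Chebyshev.roots_U_real_nodup k) (Multiset.mem_map.mpr ⟨j, Multiset.mem_range.mpr hj, rfl⟩)]

/-- **`mult(cos((2j+1)π∕2k), T_{2k} + 1) = 2`** (`j < k`): the minima of `T_{2k}` are double roots of `T_{2k} + 1`. [Rivlin §1.2; this file, §1270] -/
theorem chebyshevT_even_add_one_rootMultiplicity_cos {j k : ℕ} (hj : j < k) :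
    (Polynomial.Chebyshev.T ℝ (2 * (k : ℤ)) + 1).rootMultiplicity (cos ((2 * j + 1) * π / (2 * k))) = 2 := by
  rw [← count_roots, chebyshevT_even_add_one_roots_real, Multiset.count_nsmul,
    Multiset.count_eq_one_of_mem (Polynomial.Chebyshev.roots_T_real_nodup k) (Multiset.mem_map.mpr ⟨j, Multiset.mem_range.mpr hj, rfl⟩)]

/-- **`mult(1, T_n − 1) = 1`** (`n ≥ 1`): the endpoint `1` is a simple root of `T_n − 1`. [Rivlin §1.2; this file, §1270] -/
theorem chebyshevT_sub_one_rootMultiplicity_one {n : ℕ} (hn : n ≠ 0) : (Polynomial.Chebyshev.T ℝ (n : ℤ) - 1).rootMultiplicity 1 = 1 := by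
  obtain ⟨k, rfl | rfl⟩ := Nat.even_or_odd' n
  · obtain ⟨j, rfl⟩ := Nat.exists_eq_add_one_of_ne_zero (by rintro rfl; exact hn rfl : k ≠ 0)
    have hnot : (1 : ℝ) ∉ (Multiset.range j).map fun i : ℕ => cos ((i + 1) * π / (j + 1)) := by
      intro h
      obtain ⟨i, hi, h⟩ := Multiset.mem_map.mp h
      exact (cos_ne_one_and_ne_neg_one_of_pos_of_lt_pi (angle_half_mem (Multiset.mem_range.mp hi)).1.1 (angle_half_mem (Multiset.mem_range.mp hi)).1.2).1 h
    rw [show (((2 * (j + 1) : ℕ)) : ℤ) = 2 * ((j : ℤ) + 1) by push_cast; ring, ← count_roots, chebyshevT_even_sub_one_roots_real, Multiset.count_add, Multiset.count_nsmul,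
      Multiset.insert_eq_cons, Multiset.count_cons_self, Multiset.count_singleton, if_neg (by norm_num), Multiset.count_eq_zero.mpr hnot]
  · have hnot : (1 : ℝ) ∉ (Multiset.range k).map fun i : ℕ => cos (2 * (i + 1) * π / (2 * k + 1)) := by
      intro h
      obtain ⟨i, hi, h⟩ := Multiset.mem_map.mp h
      exact (cos_ne_one_and_ne_neg_one_of_pos_of_lt_pi (angle_even_mem (Multiset.mem_range.mp hi)).1 (angle_even_mem (Multiset.mem_range.mp hi)).2).1 h
    rw [show (((2 * k + 1 : ℕ)) : ℤ) = 2 * (k : ℤ) + 1 by push_cast; ring, ← count_roots, chebyshevT_odd_sub_one_roots_real, Multiset.count_add, Multiset.count_nsmul,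
      Multiset.count_singleton_self, Multiset.count_eq_zero.mpr hnot]

/-- **`mult(−1, T_{2k+2} − 1) = 1`**: the endpoint `−1` is a simple root of `T_n − 1` for even `n ≥ 2`. [Rivlin §1.2; this file, §1270] -/
theorem chebyshevT_even_sub_one_rootMultiplicity_neg_one (k : ℕ) : (Polynomial.Chebyshev.T ℝ (2 * ((k : ℤ) + 1)) - 1).rootMultiplicity (-1) = 1 := by
  have hnot : (-1 : ℝ) ∉ (Multiset.range k).map fun i : ℕ => cos ((i + 1) * π / (k + 1)) := by
    intro h
    obtain ⟨i, hi, h⟩ := Multiset.mem_map.mp h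
    exact (cos_ne_one_and_ne_neg_one_of_pos_of_lt_pi (angle_half_mem (Multiset.mem_range.mp hi)).1.1 (angle_half_mem (Multiset.mem_range.mp hi)).1.2).2 h
  rw [← count_roots, chebyshevT_even_sub_one_roots_real, Multiset.count_add, Multiset.count_nsmul, Multiset.insert_eq_cons, Multiset.count_cons_of_ne (by norm_num),
    Multiset.count_singleton_self, Multiset.count_eq_zero.mpr hnot]

/-- **`mult(−1, T_{2k+1} + 1) = 1`**: the endpoint `−1` is a simple root of `T_n + 1` for odd `n`. [Rivlin §1.2; this file, §1270] -/
theorem chebyshevT_odd_add_one_rootMultiplicity_neg_one (k : ℕ) : (Polynomial.Chebyshev.T ℝ (2 * (k : ℤ) + 1) + 1).rootMultiplicity (-1) = 1 := by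
  have hnot : (-1 : ℝ) ∉ (Multiset.range k).map fun i : ℕ => cos ((2 * i + 1) * π / (2 * k + 1)) := by
    intro h
    obtain ⟨i, hi, h⟩ := Multiset.mem_map.mp h
    exact (cos_ne_one_and_ne_neg_one_of_pos_of_lt_pi (angle_odd_mem (Multiset.mem_range.mp hi)).1 (angle_odd_mem (Multiset.mem_range.mp hi)).2).2 h
  rw [← count_roots, chebyshevT_odd_add_one_roots_real, Multiset.count_add, Multiset.count_nsmul, Multiset.count_singleton_self, Multiset.count_eq_zero.mpr hnot]

/-- **`mult(2cos(2(j+1)π∕(2k+1)), C_{2k+1} − 2) = 2`** (`j < k`). [Ribenboim Ch. 1 §IV; this file, §1270] -/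
theorem chebyshevC_odd_sub_two_rootMultiplicity_cos {j k : ℕ} (hj : j < k) :
    (Polynomial.Chebyshev.C ℝ (2 * (k : ℤ) + 1) - 2).rootMultiplicity (2 * cos (2 * (j + 1) * π / (2 * k + 1))) = 2 := by
  have hne : 2 * cos (2 * ((j : ℝ) + 1) * π / (2 * k + 1)) ≠ 2 := fun h =>
    (cos_ne_one_and_ne_neg_one_of_pos_of_lt_pi (angle_even_mem hj).1 (angle_even_mem hj).2).1 (by linarith)
  rw [← count_roots, chebyshevC_odd_sub_two_roots_real, Multiset.count_add, Multiset.count_nsmul, Multiset.count_singleton, if_neg hne,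
    Multiset.count_eq_one_of_mem (chebyshevS_add_pred_roots_real_nodup k) (Multiset.mem_map.mpr ⟨j, Multiset.mem_range.mpr hj, rfl⟩)]

/-- **`mult(2cos((j+1)π∕(k+1)), C_{2k+2} − 2) = 2`** (`j < k`). [Ribenboim Ch. 1 §IV; this file, §1270] -/
theorem chebyshevC_even_sub_two_rootMultiplicity_cos {j k : ℕ} (hj : j < k) :
    (Polynomial.Chebyshev.C ℝ (2 * ((k : ℤ) + 1)) - 2).rootMultiplicity (2 * cos ((j + 1) * π / (k + 1))) = 2 := by
  obtain ⟨hne1, hne2⟩ := cos_ne_one_and_ne_neg_one_of_pos_of_lt_pi (angle_half_mem hj).1.1 (angle_half_mem hj).1.2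
  have h1 : 2 * cos (((j : ℝ) + 1) * π / (k + 1)) ≠ 2 := fun h => hne1 (by linarith)
  have h2 : 2 * cos (((j : ℝ) + 1) * π / (k + 1)) ≠ -2 := fun h => hne2 (by linarith)
  rw [← count_roots, chebyshevC_even_sub_two_roots_real, Multiset.count_add, Multiset.count_nsmul, Multiset.insert_eq_cons, Multiset.count_cons_of_ne h1, Multiset.count_singleton,
    if_neg h2, Multiset.count_eq_one_of_mem (chebyshevS_roots_real_nodup k) (Multiset.mem_map.mpr ⟨j, Multiset.mem_range.mpr hj, rfl⟩)]

/-- **`mult(2, C_n − 2) = 1`** (`n ≥ 1`): `2` is a simple root of `C_n − 2` (while `C_n'(2) = n²`). [Ribenboim Ch. 1 §IV; this file, §1270] -/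
theorem chebyshevC_sub_two_rootMultiplicity_two {n : ℕ} (hn : n ≠ 0) : (Polynomial.Chebyshev.C ℝ (n : ℤ) - 2).rootMultiplicity 2 = 1 := by
  obtain ⟨k, rfl | rfl⟩ := Nat.even_or_odd' n
  · obtain ⟨j, rfl⟩ := Nat.exists_eq_add_one_of_ne_zero (by rintro rfl; exact hn rfl : k ≠ 0)
    have hnot : (2 : ℝ) ∉ (Multiset.range j).map fun i : ℕ => 2 * cos ((i + 1) * π / (j + 1)) := by
      intro h
      obtain ⟨i, hi, h⟩ := Multiset.mem_map.mp h
      exact (cos_ne_one_and_ne_neg_one_of_pos_of_lt_pi (angle_half_mem (Multiset.mem_range.mp hi)).1.1 (angle_half_mem (Multiset.mem_range.mp hi)).1.2).1 (by linarith)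
    rw [show (((2 * (j + 1) : ℕ)) : ℤ) = 2 * ((j : ℤ) + 1) by push_cast; ring, ← count_roots, chebyshevC_even_sub_two_roots_real, Multiset.count_add, Multiset.count_nsmul,
      Multiset.insert_eq_cons, Multiset.count_cons_self, Multiset.count_singleton, if_neg (by norm_num), Multiset.count_eq_zero.mpr hnot]
  · have hnot : (2 : ℝ) ∉ (Multiset.range k).map fun i : ℕ => 2 * cos (2 * (i + 1) * π / (2 * k + 1)) := by
      intro h
      obtain ⟨i, hi, h⟩ := Multiset.mem_map.mp h
      exact (cos_ne_one_and_ne_neg_one_of_pos_of_lt_pi (angle_even_mem (Multiset.mem_range.mp hi)).1 (angle_even_mem (Multiset.mem_range.mp hi)).2).1 (by linarith)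
    rw [show (((2 * k + 1 : ℕ)) : ℤ) = 2 * (k : ℤ) + 1 by push_cast; ring, ← count_roots, chebyshevC_odd_sub_two_roots_real, Multiset.count_add, Multiset.count_nsmul,
      Multiset.count_singleton_self, Multiset.count_eq_zero.mpr hnot]

end Summit.Ventures.HSemireg.Wedge.HankelOuter
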